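import Literature.NumberTheory.ModularForms.SiegelModularFormsNebentypusEquiv
import Literature.NumberTheory.ModularForms.SiegelUpperHalfSpaceEffectiveAction
import HarnessLib

/-!
# `−1_{2n} ∈ K` acts trivially on `𝔥_n`, so (2.4) at `M = −1_{2n}` forces `𝔐_k(K, χ) = 0` unless `χ(−1_{2n}) = (−1)^{nk}`
# (every degree; Klingen §4: "`nk` odd ⇒ `f = 0`" for every `K ∋ −1`; Diamond–Shurman §4.3: "`M_k(N, χ) = 0` unless `χ(−1) = (−1)^k`")

Layer `Literature/NumberTheory/ModularForms`, namespace `Literature.NumberTheory.ModularForms.SiegelModularForm` (lane `lit-hodgefound`,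
Layer A2, seat `lit-hodgefound-skel-2`, row A2-278; on A2-251 `SiegelModularFormsLevel` (`IsSiegelModularFormLevel K k χ F` = (2.4) with
conditions (1), (3)), A2-261 (`levelSpace K k χ`), A2-270 (`gamma0DirichletChar`, `symm_mem_siegelGamma0_of_mem_Gamma0`), p16's
`SiegelUpperHalfSpaceEffectiveAction` (`denom_neg`, `moeb_neg`: `(−M)⟨Z⟩ = M⟨Z⟩`), p16 `SiegelUpperHalfSpaceAction` (`moeb_one`,
`denom_fromBlocks`)).  THEOREMS ONLY (no definition, no named fact, no instance).

Source.  A–Z Ch. 2 §2.2 (2.4) (p0064): `det(CZ + D)^{−k}F(M⟨Z⟩) = χ(M)F(Z)` for all `M ∈ K`.  At `M = −E_{2n}` (when it lies in `K`):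
`M⟨Z⟩ = (−Z)(−E)⁻¹ = Z` and `det(CZ + D) = det(−E_n) = (−1)^n`, so `F(Z) = χ(−E_{2n})(−1)^{nk}F(Z)`; hence `F ≡ 0` unless
`χ(−E_{2n})(−1)^{nk} = 1`.  For `χ = 1` this is Klingen §4 (p. 44): a Siegel modular form with `nk` odd vanishes (p16
`IsSiegelModularForm.eq_zero_of_odd` for the full group; here for every `K ∋ −E_{2n}` and every `χ` with `χ(−E_{2n}) = 1`); for `n = 1`,
`K = Γ₀¹(N)`, `χ = ψ∘det D` it is Diamond–Shurman §4.3: `M_k(N, ψ) = {0}` unless `ψ(−1) = (−1)^k` (A2-264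
`modularFormNebentypus_eq_bot_of_ne` on the Mathlib side; here on the Siegel side).

## What is here

* §1 (every degree) `map_intCast_neg_one`, **`moeb_neg_one_intCast`** (`(−E)⟨Z⟩ = Z`), **`det_denom_neg_one_intCast`** (`= (−1)^n`),
  **`IsSiegelModularFormLevel.apply_eq_mul_of_coe_eq_neg_one`** (`F(Z) = χ(M)(−1)^{nk}F(Z)` for `M ∈ K` with matrix `−E_{2n}`),
  **`IsSiegelModularFormLevel.eqOn_zero_of_coe_eq_neg_one`** (`χ(M)(−1)^{nk} ≠ 1 ⇒ F = 0` on `𝔥_n`),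
  `IsSiegelModularFormLevel.eqOn_zero_of_apply_ne` (`χ(M) ≠ (−1)^{nk} ⇒ F = 0`), **`IsSiegelModularFormLevel.eqOn_zero_of_odd'`**
  (`χ(M) = 1`, `nk` odd ⇒ `F = 0`), `levelSpace_eq_bot_of_apply_ne` (`𝔐_k(K, χ) = 0`).
* §2 (degree one) `coe_symm_neg_one` (the matrix of `spOfSL(−1)` is `−E_2`), `symm_neg_one_mem_siegelGamma0`,
  `gamma0DirichletChar_symm_neg_one` (`(ψ∘det D)(−E_2) = ψ(−1)`), **`levelSpace_gamma0_eq_bot_of_ne`** (`𝔐_k(Γ₀¹(N), ψ∘det D) = 0` unless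
  `ψ(−1) = (−1)^k` — the Siegel side of D–S's parity condition, consistent with A2-264).

## References

* [AndrianovZhuravlev2015] A. N. Andrianov, V. G. Zhuravlev, *Modular Forms and Hecke Operators*, Transl. Math. Monogr. 145, AMS, Ch. 2
  §2.2 (2.4) (p0064).
* [Klingen1990] H. Klingen, *Introductory lectures on Siegel modular forms*, CUP, §4 (p. 44) ("modular forms of weight k with nk odd
  vanish identically").
* [DiamondShurman2005] F. Diamond, J. Shurman, *A First Course in Modular Forms*, GTM 228, §4.3 (p. 119), Exercise 4.3.3 (b).
-/

noncomputable section

open Complex Real Matrix Set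
open scoped MatrixGroups ModularForm

namespace Literature.NumberTheory.ModularForms

namespace SiegelModularForm

open Literature.NumberTheory.Automorphic (siegelUpperHalfSpace)
open Literature.NumberTheory.ModularForms.SiegelUpperHalfSpace
open Literature.Analysis.SpecialFunctions (isUnit_det_denom_intCast)

/-! ### §1 Every degree: `(2.4)` at `M = −E_{2n}` -/

section EveryDegree

variable {n : ℕ} {K : Subgroup (Matrix.symplecticGroup (Fin n) ℤ)} {k : ℤ} {χ : K →* ℂ} {F : Matrix (Fin n) (Fin n) ℂ → ℂ}

/-- `−E_{2n}` over `ℂ`. [cite: Klingen1990, §4 (p. 44)] -/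
theorem map_intCast_neg_one :
    (-1 : Matrix (Fin n ⊕ Fin n) (Fin n ⊕ Fin n) ℤ).map ((↑) : ℤ → ℂ) = -1 := by
  rw [Matrix.map_neg _ (fun a => Int.cast_neg a), Matrix.map_one Int.cast Int.cast_zero Int.cast_one]

/-- The denominator of `E_{2n}` is `E_n`: `0·Z + E = E`. [cite: Klingen1990, §1 (p. 1)] -/
theorem denom_one_eq (Z : Matrix (Fin n) (Fin n) ℂ) : denom (1 : Matrix (Fin n ⊕ Fin n) (Fin n ⊕ Fin n) ℂ) Z = 1 := by
  rw [← Matrix.fromBlocks_one, denom_fromBlocks, Matrix.zero_mul, zero_add]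

/-- **`(−E_{2n})⟨Z⟩ = Z`**: `−E_{2n}` acts trivially on `𝔥_n`. [cite: Klingen1990, §4 (p. 44)] [cite: AndrianovZhuravlev2015, Ch. 2 §2.2 (2.4) (p0064)] -/
theorem moeb_neg_one_intCast (Z : Matrix (Fin n) (Fin n) ℂ) :
    moeb ((-1 : Matrix (Fin n ⊕ Fin n) (Fin n ⊕ Fin n) ℤ).map ((↑) : ℤ → ℂ)) Z = Z := by
  rw [map_intCast_neg_one, moeb_neg (by rw [denom_one_eq, Matrix.det_one]; exact isUnit_one), moeb_one]

/-- **`det(CZ + D) = (−1)^n` for `M = −E_{2n}`** (`C = 0`, `D = −E_n`). [cite: Klingen1990, §4 (p. 44)] -/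
theorem det_denom_neg_one_intCast (Z : Matrix (Fin n) (Fin n) ℂ) :
    (denom ((-1 : Matrix (Fin n ⊕ Fin n) (Fin n ⊕ Fin n) ℤ).map ((↑) : ℤ → ℂ)) Z).det = (-1 : ℂ) ^ n := by
  rw [map_intCast_neg_one, denom_neg, denom_one_eq, Matrix.det_neg, Matrix.det_one, mul_one, Fintype.card_fin]

/-- **(2.4) at `M = −E_{2n} ∈ K`: `F(Z) = χ(M)·(−1)^{nk}·F(Z)`** for `F ∈ 𝔐_k(K, χ)`, `Z ∈ 𝔥_n`.
[cite: AndrianovZhuravlev2015, Ch. 2 §2.2 (2.4) (p0064)] [cite: Klingen1990, §4 (p. 44)] -/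
theorem IsSiegelModularFormLevel.apply_eq_mul_of_coe_eq_neg_one (hF : IsSiegelModularFormLevel K k χ F) {M : K}
    (hM : ((M : Matrix.symplecticGroup (Fin n) ℤ) : Matrix (Fin n ⊕ Fin n) (Fin n ⊕ Fin n) ℤ) = -1)
    {Z : Matrix (Fin n) (Fin n) ℂ} (hZ : Z ∈ siegelUpperHalfSpace n) :
    F Z = χ M * ((-1 : ℂ) ^ n) ^ k * F Z := by
  have h := hF.transform M Z hZ
  rw [hM, moeb_neg_one_intCast, det_denom_neg_one_intCast] at h
  exact h

/-- **`𝔐_k(K, χ) = 0` unless `χ(−E_{2n})(−1)^{nk} = 1`**: if `M ∈ K` has matrix `−E_{2n}` and `χ(M)(−1)^{nk} ≠ 1`, every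
`F ∈ 𝔐_k(K, χ)` vanishes on `𝔥_n`. [cite: AndrianovZhuravlev2015, Ch. 2 §2.2 (2.4) (p0064)] [cite: Klingen1990, §4 (p. 44)] [cite: DiamondShurman2005, §4.3 (p. 119)] -/
theorem IsSiegelModularFormLevel.eqOn_zero_of_coe_eq_neg_one (hF : IsSiegelModularFormLevel K k χ F) {M : K}
    (hM : ((M : Matrix.symplecticGroup (Fin n) ℤ) : Matrix (Fin n ⊕ Fin n) (Fin n ⊕ Fin n) ℤ) = -1)
    (hχ : χ M * ((-1 : ℂ) ^ n) ^ k ≠ 1) : EqOn F 0 (siegelUpperHalfSpace n) := by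
  intro Z hZ
  have h := hF.apply_eq_mul_of_coe_eq_neg_one hM hZ
  have h' : (1 - χ M * ((-1 : ℂ) ^ n) ^ k) * F Z = 0 := by
    rw [sub_mul, one_mul, ← h, sub_self]
  exact (mul_eq_zero.1 h').resolve_left (sub_ne_zero.2 (Ne.symm hχ))

/-- `((−1)^n)^k` is an involution. [cite: Klingen1990, §4 (p. 44)] -/
theorem neg_one_pow_zpow_mul_self (n : ℕ) (k : ℤ) : ((-1 : ℂ) ^ n) ^ k * ((-1 : ℂ) ^ n) ^ k = 1 := by
  rw [← mul_zpow, ← pow_add, ← two_mul, pow_mul, neg_one_sq, one_pow, _root_.one_zpow]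

/-- The same with the hypothesis `χ(M) ≠ (−1)^{nk}` (equivalent, `((−1)^n)^k` being an involution).
[cite: AndrianovZhuravlev2015, Ch. 2 §2.2 (2.4) (p0064)] [cite: DiamondShurman2005, §4.3 (p. 119, "unless χ(−1) = (−1)^k")] -/
theorem IsSiegelModularFormLevel.eqOn_zero_of_apply_ne (hF : IsSiegelModularFormLevel K k χ F) {M : K}
    (hM : ((M : Matrix.symplecticGroup (Fin n) ℤ) : Matrix (Fin n ⊕ Fin n) (Fin n ⊕ Fin n) ℤ) = -1)
    (hχ : χ M ≠ ((-1 : ℂ) ^ n) ^ k) : EqOn F 0 (siegelUpperHalfSpace n) := by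
  refine hF.eqOn_zero_of_coe_eq_neg_one hM fun h1 => hχ ?_
  calc χ M = χ M * (((-1 : ℂ) ^ n) ^ k * ((-1 : ℂ) ^ n) ^ k) := by rw [neg_one_pow_zpow_mul_self, mul_one]
    _ = χ M * ((-1 : ℂ) ^ n) ^ k * ((-1 : ℂ) ^ n) ^ k := by ring
    _ = ((-1 : ℂ) ^ n) ^ k := by rw [h1, one_mul]

/-- **Klingen's parity vanishing for every `K ∋ −E_{2n}`**: if `χ(M) = 1` for the element `M ∈ K` with matrix `−E_{2n}` and `nk` is odd,
then `𝔐_k(K, χ) = 0` ("modular forms of weight `k` with `nk` odd vanish identically"; p16 `IsSiegelModularForm.eq_zero_of_odd` is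
`K = Γⁿ`, `χ = 1`). [cite: Klingen1990, §4 (p. 44)] -/
theorem IsSiegelModularFormLevel.eqOn_zero_of_odd' (hF : IsSiegelModularFormLevel K k χ F) {M : K}
    (hM : ((M : Matrix.symplecticGroup (Fin n) ℤ) : Matrix (Fin n ⊕ Fin n) (Fin n ⊕ Fin n) ℤ) = -1) (h1 : χ M = 1)
    (hnk : Odd ((n : ℤ) * k)) : EqOn F 0 (siegelUpperHalfSpace n) := by
  refine hF.eqOn_zero_of_apply_ne hM ?_
  rw [h1, ← zpow_natCast, ← _root_.zpow_mul, hnk.neg_one_zpow]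
  norm_num

/-- **`𝔐_k(K, χ) = 0` as a vector space** when `χ(−E_{2n}) ≠ (−1)^{nk}` (`−E_{2n} ∈ K`).
[cite: AndrianovZhuravlev2015, Ch. 2 §2.2 (p0064)] [cite: DiamondShurman2005, §4.3 (p. 119)] -/
theorem levelSpace_eq_bot_of_apply_ne {M : K}
    (hM : ((M : Matrix.symplecticGroup (Fin n) ℤ) : Matrix (Fin n ⊕ Fin n) (Fin n ⊕ Fin n) ℤ) = -1)
    (hχ : χ M ≠ ((-1 : ℂ) ^ n) ^ k) : levelSpace K k χ = ⊥ := by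
  rw [Submodule.eq_bot_iff]
  intro F hF
  exact eq_of_mem_levelSpace_of_eqOn hF (Submodule.zero_mem _)
    ((isSiegelModularFormLevel_of_mem_levelSpace hF).eqOn_zero_of_apply_ne hM hχ)

end EveryDegree

/-! ### §2 Degree one: `−E_2 = spOfSL(−1) ∈ Γ₀¹(N)` and the parity condition for `ψ∘det D` -/

section DegreeOne

open CongruenceSubgroup

/-- The matrix of `spOfSL(−1)` is `−E_2`. [cite: AndrianovZhuravlev2015, Ch. 3 §3.1 ("Sp_1(Z) = SL_2(Z)") (p0129)] -/
theorem coe_symm_neg_one :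
    ((symplecticGroupFinOneEquiv.symm (-1 : SL(2, ℤ)) : Matrix.symplecticGroup (Fin 1) ℤ) :
      Matrix (Fin 1 ⊕ Fin 1) (Fin 1 ⊕ Fin 1) ℤ) = -1 := by
  rw [coe_symplecticGroupFinOneEquiv_symm, spOfSL]
  have h : ((-1 : SL(2, ℤ)) : Matrix (Fin 2) (Fin 2) ℤ) = -1 := by
    rw [Matrix.SpecialLinearGroup.coe_neg, Matrix.SpecialLinearGroup.coe_one]
  ext (i | i) (j | j) <;>
    simp [h, Matrix.fromBlocks_apply₁₁, Matrix.fromBlocks_apply₁₂, Matrix.fromBlocks_apply₂₁, Matrix.fromBlocks_apply₂₂,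
      Subsingleton.elim i 0, Subsingleton.elim j 0]

variable (N : ℕ)

/-- `spOfSL(−1) ∈ Γ₀¹(N)` (`−1 ∈ Γ₀(N)`). [cite: DiamondShurman2005, §4.3 (p. 119)] -/
theorem symm_neg_one_mem_siegelGamma0 : symplecticGroupFinOneEquiv.symm (-1 : SL(2, ℤ)) ∈ siegelGamma0 1 N := by
  refine symm_mem_siegelGamma0_of_mem_Gamma0 ?_
  rw [Gamma0_mem, Matrix.SpecialLinearGroup.coe_neg, Matrix.SpecialLinearGroup.coe_one]
  simp

/-- `(ψ∘det D)(−E_2) = ψ(−1)`. [cite: AndrianovZhuravlev2015, Ch. 1 §4.4 (4.31)–(4.32) ("χ_Q(−1) = (−1)^k") (p0041)] [cite: DiamondShurman2005, §4.3 (p. 119)] -/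
theorem gamma0DirichletChar_symm_neg_one (ψ : DirichletCharacter ℂ N) :
    gamma0DirichletChar 1 N ψ ⟨symplecticGroupFinOneEquiv.symm (-1 : SL(2, ℤ)), symm_neg_one_mem_siegelGamma0 N⟩ = ψ (-1) := by
  rw [gamma0DirichletChar_symm_apply]
  simp [Matrix.SpecialLinearGroup.coe_neg]

/-- **The Siegel side of Diamond–Shurman's parity condition: `𝔐_k(Γ₀¹(N), ψ∘det D) = 0` unless `ψ(−1) = (−1)^k`** (A2-264
`modularFormNebentypus_eq_bot_of_ne` is the Mathlib side `M_k(N, ψ) = 0`). [cite: DiamondShurman2005, §4.3 (p. 119), Exercise 4.3.3 (b)] [cite: AndrianovZhuravlev2015, Ch. 2 §2.2 (2.4) (p0064)] -/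
theorem levelSpace_gamma0_eq_bot_of_ne {k : ℤ} (ψ : DirichletCharacter ℂ N) (hψ : ψ (-1) ≠ (-1 : ℂ) ^ k) :
    levelSpace (siegelGamma0 1 N) k (gamma0DirichletChar 1 N ψ) = ⊥ := by
  refine levelSpace_eq_bot_of_apply_ne (M := ⟨symplecticGroupFinOneEquiv.symm (-1 : SL(2, ℤ)), symm_neg_one_mem_siegelGamma0 N⟩)
    coe_symm_neg_one ?_
  rw [gamma0DirichletChar_symm_neg_one, pow_one]
  exact hψ

end DegreeOne

end SiegelModularForm

end Literature.NumberTheory.ModularForms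

end
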